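import Summits.QuantumFields.BalabanUV.T4Continuum.Support.BlockAverageDbarLinNorms
import Summits.QuantumFields.BalabanUV.T4Continuum.Support.NE3TangentCovariantTower
import HarnessLib

/-!
# NE7TransportDeviationLetters — transports and linearised transports of a unitary background with LINK RADIUS `η` against the flat background:
# `‖W(Γ) − 1‖ ≤ |Γ|η`, `‖(δ_YW)(Γ) − (δ_Y1)(Γ)‖ ≤ 2η|Γ|·Σ_{b⊂Γ}‖Y(b)‖`, the main term of the double-bar average `‖Ad_{u⁻¹}S_W(c) − S_1(c)‖ ≤ (2η̄ + 2(d+1)Lη)segL1(c)`,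
# and the flat identities `dbarLin 1 = S_1 = Qcoarse` — the letters of the one-level `ℓ¹` Lipschitz bound of `Q̄_W − Q` (F49b `NE7QbarLipschitzOneLevel`)

Cell `pub-balaban`, rung (B)+1 sub-cell t4, lineage `b2b-balaban-t4-ne7-p1`, generation 71 (CRUX PROVER NE7 #1); memo
`t4/b2b-balaban-t4-ne7-p1-g71/HUNT-H15-EXP-LANDED-TT-CURRENCY.md` §2 (TT-Q).  File F49a (over row NE3 leaf-10's `BlockAverageDbarLinBound`
(`segMain`, `segL1`, `norm_segMain_le`, `norm_dbarLin_sub_main_le`), leaf-04's `NE3TangentCovariantTower` (`Qbar_flat`), the transport calculus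
`AveragingDeficitTransport` (`dhol`, `dstep`, `lnorm`, `norm_dhol_le`), `AveragingDeficitNearIdentity.norm_Ad_sub_le`, and the tree's `hol_flat`, `bavg_flat`).
WHY (memo H15 §1–§2).  The repaired test-field transport (TT) of (APE) at the trivial flat datum needs the `ℓ¹` Lipschitz bound of the straight double-bar
tower `Q̄^{(k+1)}_Ũ − Q^{(k+1)}` in the LINK radii of the backgrounds `cavgIter j Ũ`; its one-level input (F49b) compares leaf-10's decomposition
`dbarLin_W = Ad_{V̄⁻¹}S_W + E_W` at `W` and at `1`.  THIS FILE supplies the elementary deviation letters: transports along words, linearised transports,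
the main term `S_W` against `S_1`, and the flat side (`E_1 = 0`, `V̄ = 1`).
WHAT ([folklore]; 0 def, 0 sorry).
§1 `norm_inv_sub_one_eq`, `norm_stepHol_sub_one_le`, **`norm_hol_sub_one_le_length`** (`‖W(Γ) − 1‖ ≤ |Γ|η`; the matrix
   form of lit-balaban's `B9Eq315QLipschitz.norm_hol_sub_one_le`), `norm_Wcx_sub_one_le_of_links` (loop radius `≤ 2(d+1)Lη`), `stepHol_flat`, **`norm_dhol_sub_dhol_flat_le`** (`‖(δ_YW)(Γ) − (δ_Y1)(Γ)‖ ≤ 2η|Γ|·Σ_{b⊂Γ}‖Y(b)‖`, induction on the word).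
§2 **`norm_Ad_segMain_sub_flat_le`**: `‖Ad_{u⁻¹}S_W(c) − S_1(c)‖ ≤ (2η̄ + 2(d+1)Lη)·segL1(c)` for unitary `u` within `η̄` of `1` (tree words `≤ dL`, segments `L`).
§3 `Wcx_flat`, **`dbarLin_flat_eq_segMain`** (`dbarLin L 1 Y c = S_1(c)`: leaf-10's error vanishes at loop radius `0`), `Qcoarse_eq_segMain_flat`.
HONEST FRAMING (page 1): lattice kinematics; nothing of Bałaban's asserted; NOT (TT), NOT (APE), NOT ONE-STEP, NOT NE7; spine 0∕9; finite T⁴ rung (B)+1 —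
NOT infinite volume, NOT mass gap, NOT Clay.  Continuum YM on T⁴ ⇐ BetaPertH ∧ nine spine estimates (0/9 proved); BetaPertH ⇐ (D1) ∧ (D4) ∧ CAP+tail;
G-an2-4 gates asym, D1 and NE2/3/4.
-/

set_option autoImplicit false

open scoped BigOperators Matrix.Norms.L2Operator
open NormedSpace Finset

namespace Summit.QuantumFields.BalabanUV.T4Continuum.NE7TransportDeviationLetters

open Literature.MathematicalPhysics.QuantumFieldTheory.Balaban1983to89
open B7Prop1Explicit B7Prop2Explicit MatrixLog UnitaryModel
open T4AveragingDeficitWall (IsUnitaryCfg Ad hol_flat bavg_flat flat_mem_classes)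
open T4AveragingDeficitNonAbelian (Ad_sub)
open AveragingDeficitTransport (dhol dhol_nil dhol_cons dstep lnorm lnorm_nil lnorm_cons norm_dhol_le norm_Ad_of_unitary
  val_inv_eq_star_of_unitary mem_U1_of_unitary)
open AveragingDeficitNearIdentity (norm_Ad_sub_le Ad_one)
open BlockAveragePushDirSplit (flat dbarLin)
open BlockAverageDbarLinBound (segMain segL1 norm_segMain_le norm_dbarLin_sub_main_le lnorm_nonneg segL1_nonneg)
open NE3TangentFlatStructure (Qcoarse)
open NE3TangentCovariantStructure (Qbar)
open NE3TangentCovariantTower (Qbar_flat)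

noncomputable section

variable {d : ℕ} {n : Type*} [Fintype n] [DecidableEq n]

/-! ## §1 Deviation letters on `U(N)` data with link radius `η` -/

/-- For a unitary unit `u`, `‖u⁻¹ − 1‖ = ‖u − 1‖`. [folklore] -/
theorem norm_inv_sub_one_eq [Nonempty n] {u : (Matrix n n ℂ)ˣ} (hu : u ∈ unitaryUnits (Matrix n n ℂ)) :
    ‖((u⁻¹ : (Matrix n n ℂ)ˣ) : Matrix n n ℂ) - 1‖ = ‖(u : Matrix n n ℂ) - 1‖ := by
  rw [val_inv_eq_star_of_unitary hu]
  calc ‖star (u : Matrix n n ℂ) - 1‖ = ‖star ((u : Matrix n n ℂ) - 1)‖ := by rw [star_sub, star_one]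
    _ = ‖(u : Matrix n n ℂ) - 1‖ := norm_star _

/-- One letter: `‖W(b)^{±1} − 1‖ ≤ η` when every link of the unitary `W` is within `η` of `1`. [folklore] -/
theorem norm_stepHol_sub_one_le [Nonempty n] {W : Site d → Fin d → (Matrix n n ℂ)ˣ} (hW : IsUnitaryCfg W) {η : ℝ}
    (hη : ∀ (x : Site d) (μ : Fin d), ‖((W x μ : (Matrix n n ℂ)ˣ) : Matrix n n ℂ) - 1‖ ≤ η) (x : Site d) (l : Letter d) :
    ‖((stepHol W x l : (Matrix n n ℂ)ˣ) : Matrix n n ℂ) - 1‖ ≤ η := by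
  obtain ⟨μ, b⟩ := l
  cases b
  · simp only [stepHol, Bool.false_eq_true, ↓reduceIte]
    rw [norm_inv_sub_one_eq (hW _ μ)]
    exact hη _ μ
  · simp only [stepHol, ↓reduceIte]
    exact hη x μ

/-- **`‖W(Γ) − 1‖ ≤ |Γ|·η`** for the parallel transport of a unitary `W` with link radius `η` along any word (telescoping; the matrix form of
lit-balaban's `B9Eq315QLipschitz.norm_hol_sub_one_le`). [folklore] -/
theorem norm_hol_sub_one_le_length [Nonempty n] {W : Site d → Fin d → (Matrix n n ℂ)ˣ} (hW : IsUnitaryCfg W) {η : ℝ}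
    (hη : ∀ (x : Site d) (μ : Fin d), ‖((W x μ : (Matrix n n ℂ)ˣ) : Matrix n n ℂ) - 1‖ ≤ η) :
    ∀ (x : Site d) (w : List (Letter d)), ‖((hol W x w : (Matrix n n ℂ)ˣ) : Matrix n n ℂ) - 1‖ ≤ w.length * η
  | x, [] => by simp
  | x, l :: w => by
      rw [hol_cons, Units.val_mul, List.length_cons, Nat.cast_succ, add_mul, one_mul, add_comm ((w.length : ℝ) * η)]
      have h1 : ‖((hol W (x + l.vec) w : (Matrix n n ℂ)ˣ) : Matrix n n ℂ)‖ ≤ 1 :=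
        (mem_U1_of_unitary (hol_mem_of (S := unitaryUnits (Matrix n n ℂ)) (fun y μ => hW y μ) _ w)).1
      -- `XY − 1 = (X − 1)Y + (Y − 1)`
      have hprod : ∀ X Y : Matrix n n ℂ, ‖Y‖ ≤ 1 → ‖X * Y - 1‖ ≤ ‖X - 1‖ + ‖Y - 1‖ := fun X Y hY => by
        rw [show X * Y - 1 = (X - 1) * Y + (Y - 1) by noncomm_ring]
        exact (norm_add_le _ _).trans (add_le_add ((norm_mul_le _ _).trans (mul_le_of_le_one_right (norm_nonneg _) hY)) le_rfl)
      exact (hprod _ _ h1).trans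
        (add_le_add (norm_stepHol_sub_one_le hW hη x l) (norm_hol_sub_one_le_length hW hη (x + l.vec) w))

/-- **The loop radius from the link radius**: `‖W_{c,x} − 1‖ ≤ 2(d+1)L·η` (a loop of `2|x − c₋|₁ + 2L ≤ 2(d+1)L` links). [folklore] -/
theorem norm_Wcx_sub_one_le_of_links [Nonempty n] (L : ℕ) {W : Site d → Fin d → (Matrix n n ℂ)ˣ} (hW : IsUnitaryCfg W) {η : ℝ}
    (hη : ∀ (x : Site d) (μ : Fin d), ‖((W x μ : (Matrix n n ℂ)ˣ) : Matrix n n ℂ) - 1‖ ≤ η) (hη0 : 0 ≤ η)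
    (q : Site d) (κ : Fin d) (r : Fin d → Fin L) :
    ‖((Wcx L W q κ (boxVec L r) : (Matrix n n ℂ)ˣ) : Matrix n n ℂ) - 1‖ ≤ 2 * ((d : ℝ) + 1) * L * η := by
  rw [Wcx_eq_hol_loop]
  refine (norm_hol_sub_one_le_length hW hη q _).trans ?_
  rw [List.length_append, length_gammaWord, length_seg]
  have h1 : (l1 (boxVec L r) : ℝ) ≤ d * L := by exact_mod_cast l1_boxVec_le L r
  have h2 : (((-(L : ℤ)).natAbs : ℕ) : ℝ) = L := by simp
  push_cast
  rw [h2]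
  nlinarith

/-- The letters of the flat background are `1`. [folklore] -/
theorem stepHol_flat (x : Site d) (l : Letter d) : stepHol (flat (d := d) (n := n)) x l = 1 := by
  obtain ⟨μ, b⟩ := l
  cases b <;> simp [stepHol, BlockAveragePushDirSplit.flat]

/-- **THE LINEARISED TRANSPORT IS LIPSCHITZ IN THE BACKGROUND**: for a unitary `W` with link radius `η` and any word `Γ`,
`‖(δ_YW)(Γ) − (δ_Y1)(Γ)‖ ≤ 2η·|Γ|·Σ_{b⊂Γ}‖Y(b)‖` (induction on the word: a positive letter costs `‖Ad_{W(b)}Y − Y‖ ≤ 2η‖Y‖`, the transported tail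
costs `‖Ad_{W(l)}D − D₁‖ ≤ ‖D − D₁‖ + 2η‖D₁‖`). [folklore] -/
theorem norm_dhol_sub_dhol_flat_le [Nonempty n] {W : Site d → Fin d → (Matrix n n ℂ)ˣ} (hW : IsUnitaryCfg W) {η : ℝ}
    (hη : ∀ (x : Site d) (μ : Fin d), ‖((W x μ : (Matrix n n ℂ)ˣ) : Matrix n n ℂ) - 1‖ ≤ η) (Y : Site d → Fin d → Matrix n n ℂ) :
    ∀ (x : Site d) (w : List (Letter d)),
      ‖dhol W Y x w - dhol (flat (d := d) (n := n)) Y x w‖ ≤ 2 * η * w.length * lnorm Y x w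
  | x, [] => by simp
  | x, l :: w => by
      have hη0 : 0 ≤ η := (norm_nonneg _).trans (hη x l.1)
      rw [dhol_cons, dhol_cons, lnorm_cons, List.length_cons, stepHol_flat, Ad_one]
      push_cast
      set D := dhol W Y (x + l.vec) w with hD
      set D₀ := dhol (flat (d := d) (n := n)) Y (x + l.vec) w with hD₀
      have ih : ‖D - D₀‖ ≤ 2 * η * w.length * lnorm Y (x + l.vec) w := norm_dhol_sub_dhol_flat_le hW hη Y (x + l.vec) w
      have hln : 0 ≤ lnorm Y (x + l.vec) w := lnorm_nonneg Y _ w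
      have hD₀n : ‖D₀‖ ≤ lnorm Y (x + l.vec) w := norm_dhol_le (flat_mem_classes (d := d) (n := n) le_rfl).1 Y _ w
      -- the letter
      have hds : ‖dstep W Y x l - dstep (flat (d := d) (n := n)) Y x l‖ ≤ 2 * η * ‖Y (if l.2 then x else x + l.vec) l.1‖ := by
        obtain ⟨μ, b⟩ := l
        cases b
        · simp only [dstep, Bool.false_eq_true, ↓reduceIte, sub_self, norm_zero]
          positivity
        · simp only [dstep, ↓reduceIte, BlockAveragePushDirSplit.flat, Ad_one]
          exact (norm_Ad_sub_le (hW x μ) (Y x μ)).trans (by nlinarith [hη x μ, norm_nonneg (Y x μ), norm_nonneg (((W x μ : (Matrix n n ℂ)ˣ) : Matrix n n ℂ) - 1)])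
      -- the transported tail
      have hu : stepHol W x l ∈ unitaryUnits (Matrix n n ℂ) := by
        obtain ⟨μ, b⟩ := l
        cases b
        · exact (unitaryUnits (Matrix n n ℂ)).inv_mem (hW _ μ)
        · exact hW x μ
      have htail : ‖Ad (stepHol W x l) D - D₀‖ ≤ ‖D - D₀‖ + 2 * η * ‖D₀‖ := by
        have e : Ad (stepHol W x l) D - D₀ = Ad (stepHol W x l) (D - D₀) + (Ad (stepHol W x l) D₀ - D₀) := by rw [Ad_sub]; abel
        rw [e]
        refine (norm_add_le _ _).trans ?_
        rw [norm_Ad_of_unitary hu]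
        refine add_le_add le_rfl ((norm_Ad_sub_le hu D₀).trans ?_)
        have h1 := norm_stepHol_sub_one_le hW hη x l
        nlinarith [norm_nonneg D₀, norm_nonneg (((stepHol W x l : (Matrix n n ℂ)ˣ) : Matrix n n ℂ) - 1)]
      -- assemble
      have e2 : dstep W Y x l + Ad (stepHol W x l) D - (dstep (flat (d := d) (n := n)) Y x l + D₀)
          = (dstep W Y x l - dstep (flat (d := d) (n := n)) Y x l) + (Ad (stepHol W x l) D - D₀) := by abel
      rw [e2]
      refine (norm_add_le _ _).trans ?_
      have hy0 : 0 ≤ ‖Y (if l.2 then x else x + l.vec) l.1‖ := norm_nonneg _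
      have hlen : 0 ≤ (w.length : ℝ) := Nat.cast_nonneg _
      have hpos : 0 ≤ 2 * η * (w.length : ℝ) * ‖Y (if l.2 then x else x + l.vec) l.1‖ := by positivity
      have h4 : 2 * η * ‖D₀‖ ≤ 2 * η * lnorm Y (x + l.vec) w := mul_le_mul_of_nonneg_left hD₀n (by positivity)
      have hsum := add_le_add hds htail
      have e3 : 2 * η * ((w.length : ℝ) + 1) * (‖Y (if l.2 then x else x + l.vec) l.1‖ + lnorm Y (x + l.vec) w)
          = 2 * η * ‖Y (if l.2 then x else x + l.vec) l.1‖
            + (2 * η * (w.length : ℝ) * lnorm Y (x + l.vec) w + 2 * η * lnorm Y (x + l.vec) w)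
            + 2 * η * (w.length : ℝ) * ‖Y (if l.2 then x else x + l.vec) l.1‖ := by ring
      rw [e3]
      linarith

/-! ## §2 The main term is Lipschitz in the background -/

/-- **`‖Ad_{u⁻¹} S_W(c) − S_1(c)‖ ≤ (2η̄ + 2(d+1)Lη)·segL1(c)`** for a unitary `W` with link radius `η ≥ 0`, a unitary `u` with `‖u − 1‖ ≤ η̄`
(in the application `u = V̄(c) = (cavg L W)(z,κ)`): the tree transports `W(Γ_{c₋,x})` are words of `≤ dL` links, the straight segments of `L` links
(§1), and `Ad` is isometric. [folklore] -/
theorem norm_Ad_segMain_sub_flat_le [Nonempty n] (L : ℕ) {W : Site d → Fin d → (Matrix n n ℂ)ˣ} (hW : IsUnitaryCfg W) {η : ℝ}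
    (hη : ∀ (x : Site d) (μ : Fin d), ‖((W x μ : (Matrix n n ℂ)ˣ) : Matrix n n ℂ) - 1‖ ≤ η) (hη0 : 0 ≤ η)
    {u : (Matrix n n ℂ)ˣ} (hu : u ∈ unitaryUnits (Matrix n n ℂ)) {ηb : ℝ} (hub : ‖(u : Matrix n n ℂ) - 1‖ ≤ ηb)
    (Y : Site d → Fin d → Matrix n n ℂ) (q : Site d) (κ : Fin d) :
    ‖Ad u⁻¹ (segMain L W Y q κ) - segMain L (flat (d := d) (n := n)) Y q κ‖
      ≤ (2 * ηb + 2 * (((d : ℝ) + 1) * L) * η) * segL1 L Y q κ := by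
  have hηb0 : 0 ≤ ηb := (norm_nonneg _).trans hub
  -- termwise
  have hterm : ∀ r : Fin d → Fin L,
      ‖Ad (hol W q (treeWord (boxVec L r))) (dhol W Y (q + boxVec L r) (seg κ L))
          - dhol (flat (d := d) (n := n)) Y (q + boxVec L r) (seg κ L)‖
        ≤ 2 * (((d : ℝ) + 1) * L) * η * lnorm Y (q + boxVec L r) (seg κ L) := by
    intro r
    set h : (Matrix n n ℂ)ˣ := hol W q (treeWord (boxVec L r)) with hh
    set D := dhol W Y (q + boxVec L r) (seg κ L) with hD
    set D₀ := dhol (flat (d := d) (n := n)) Y (q + boxVec L r) (seg κ L) with hD₀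
    have hhu : h ∈ unitaryUnits (Matrix n n ℂ) := hol_mem_of (S := unitaryUnits (Matrix n n ℂ)) (fun y μ => hW y μ) _ _
    have hh1 : ‖(h : Matrix n n ℂ) - 1‖ ≤ ((d : ℝ) * L) * η := by
      refine (norm_hol_sub_one_le_length hW hη q _).trans ?_
      rw [length_treeWord]
      exact mul_le_mul_of_nonneg_right (by exact_mod_cast l1_boxVec_le L r) hη0
    have hln : 0 ≤ lnorm Y (q + boxVec L r) (seg κ L) := lnorm_nonneg Y _ _
    have hDD : ‖D - D₀‖ ≤ 2 * η * L * lnorm Y (q + boxVec L r) (seg κ L) := by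
      have := norm_dhol_sub_dhol_flat_le hW hη Y (q + boxVec L r) (seg κ L)
      rwa [length_seg, Int.natAbs_natCast] at this
    have hD₀n : ‖D₀‖ ≤ lnorm Y (q + boxVec L r) (seg κ L) := norm_dhol_le (flat_mem_classes (d := d) (n := n) le_rfl).1 Y _ _
    have e : Ad h D - D₀ = Ad h (D - D₀) + (Ad h D₀ - D₀) := by rw [Ad_sub]; abel
    rw [e]
    refine (norm_add_le _ _).trans ?_
    rw [norm_Ad_of_unitary hhu]
    have h2 := norm_Ad_sub_le hhu D₀
    have h3 : 2 * ‖(h : Matrix n n ℂ) - 1‖ * ‖D₀‖ ≤ 2 * (((d : ℝ) * L) * η) * lnorm Y (q + boxVec L r) (seg κ L) :=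
      mul_le_mul (mul_le_mul_of_nonneg_left hh1 (by norm_num)) hD₀n (norm_nonneg _) (by positivity)
    calc ‖D - D₀‖ + ‖Ad h D₀ - D₀‖ ≤ 2 * η * L * lnorm Y (q + boxVec L r) (seg κ L) + 2 * (((d : ℝ) * L) * η) * lnorm Y (q + boxVec L r) (seg κ L) :=
          add_le_add hDD (h2.trans h3)
      _ = 2 * (((d : ℝ) + 1) * L) * η * lnorm Y (q + boxVec L r) (seg κ L) := by ring
  -- the main terms at `W` and at `1`
  have hS1 : segMain L (flat (d := d) (n := n)) Y q κ
      = ∑ r : Fin d → Fin L, (((L : ℝ) ^ d)⁻¹) • dhol (flat (d := d) (n := n)) Y (q + boxVec L r) (seg κ L) := by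
    unfold segMain
    refine Finset.sum_congr rfl fun r _ => ?_
    have : hol (flat (d := d) (n := n)) q (treeWord (boxVec L r)) = 1 := hol_flat q _
    rw [this, Ad_one]
  have hdiff : ‖segMain L W Y q κ - segMain L (flat (d := d) (n := n)) Y q κ‖ ≤ 2 * (((d : ℝ) + 1) * L) * η * segL1 L Y q κ := by
    rw [hS1]
    unfold segMain segL1
    rw [← Finset.sum_sub_distrib, Finset.mul_sum]
    refine (norm_sum_le _ _).trans (Finset.sum_le_sum fun r _ => ?_)
    rw [← smul_sub, norm_smul, norm_inv, norm_pow, Real.norm_natCast]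
    calc ((L : ℝ) ^ d)⁻¹ * ‖Ad (hol W q (treeWord (boxVec L r))) (dhol W Y (q + boxVec L r) (seg κ L))
          - dhol (flat (d := d) (n := n)) Y (q + boxVec L r) (seg κ L)‖
        ≤ ((L : ℝ) ^ d)⁻¹ * (2 * (((d : ℝ) + 1) * L) * η * lnorm Y (q + boxVec L r) (seg κ L)) :=
          mul_le_mul_of_nonneg_left (hterm r) (by positivity)
      _ = 2 * (((d : ℝ) + 1) * L) * η * (((L : ℝ) ^ d)⁻¹ * lnorm Y (q + boxVec L r) (seg κ L)) := by ring
  -- the rotation by `u⁻¹`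
  have hu' : u⁻¹ ∈ unitaryUnits (Matrix n n ℂ) := (unitaryUnits (Matrix n n ℂ)).inv_mem hu
  have hS1n : ‖segMain L (flat (d := d) (n := n)) Y q κ‖ ≤ segL1 L Y q κ := norm_segMain_le L (flat_mem_classes (d := d) (n := n) le_rfl).1 Y q κ
  have hsl : 0 ≤ segL1 L Y q κ := segL1_nonneg L Y q κ
  have hinv : ‖((u⁻¹ : (Matrix n n ℂ)ˣ) : Matrix n n ℂ) - 1‖ ≤ ηb := by rw [norm_inv_sub_one_eq hu]; exact hub
  have e : Ad u⁻¹ (segMain L W Y q κ) - segMain L (flat (d := d) (n := n)) Y q κ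
      = Ad u⁻¹ (segMain L W Y q κ - segMain L (flat (d := d) (n := n)) Y q κ)
        + (Ad u⁻¹ (segMain L (flat (d := d) (n := n)) Y q κ) - segMain L (flat (d := d) (n := n)) Y q κ) := by
    rw [Ad_sub]; abel
  rw [e]
  refine (norm_add_le _ _).trans ?_
  rw [norm_Ad_of_unitary hu']
  have h2 := norm_Ad_sub_le hu' (segMain L (flat (d := d) (n := n)) Y q κ)
  have h3 : 2 * ‖((u⁻¹ : (Matrix n n ℂ)ˣ) : Matrix n n ℂ) - 1‖ * ‖segMain L (flat (d := d) (n := n)) Y q κ‖ ≤ 2 * ηb * segL1 L Y q κ :=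
    mul_le_mul (mul_le_mul_of_nonneg_left hinv (by norm_num)) hS1n (norm_nonneg _) (by positivity)
  calc ‖segMain L W Y q κ - segMain L (flat (d := d) (n := n)) Y q κ‖
        + ‖Ad u⁻¹ (segMain L (flat (d := d) (n := n)) Y q κ) - segMain L (flat (d := d) (n := n)) Y q κ‖
      ≤ 2 * (((d : ℝ) + 1) * L) * η * segL1 L Y q κ + 2 * ηb * segL1 L Y q κ := add_le_add hdiff (h2.trans h3)
    _ = (2 * ηb + 2 * (((d : ℝ) + 1) * L) * η) * segL1 L Y q κ := by ring

/-! ## §3 The flat identities: leaf-10's error vanishes at `w = 0` -/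

/-- The loop variables of the flat background are `1`. [folklore] -/
theorem Wcx_flat (L : ℕ) (q : Site d) (κ : Fin d) (r : Site d) :
    ((Wcx L (flat (d := d) (n := n)) q κ r : (Matrix n n ℂ)ˣ) : Matrix n n ℂ) = 1 := by
  rw [Wcx_eq_hol_loop]
  have : hol (flat (d := d) (n := n)) q (gammaWord L κ r ++ seg κ (-(L : ℤ))) = 1 := hol_flat q _
  rw [this, Units.val_one]

/-- **`dbarLin L 1 Y c = S_1(c)`**: at the flat background the linearised double-bar average IS the block average of the straight segments
(leaf-10's `norm_dbarLin_sub_main_le` with loop radius `w = 0`, `V̄ = 1`). [folklore] -/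
theorem dbarLin_flat_eq_segMain [Nonempty n] (L : ℕ) (hL : 1 ≤ L) (Y : Site d → Fin d → Matrix n n ℂ) (q : Site d) (κ : Fin d) :
    dbarLin L (flat (d := d) (n := n)) Y q κ = segMain L (flat (d := d) (n := n)) Y q κ := by
  have h := norm_dbarLin_sub_main_le L hL (flat_mem_classes (d := d) (n := n) le_rfl).1 Y q κ (w := 0) (by norm_num)
    (fun r => by rw [Wcx_flat, sub_self, norm_zero])
  rw [zero_mul] at h
  have h0 := norm_le_zero_iff.mp h
  rw [sub_eq_zero] at h0
  rw [h0]
  have hb : bavg L (flat (d := d) (n := n)) q κ = 1 := by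
    have := bavg_flat (d := d) (n := n) L
    exact congr_fun (congr_fun this q) κ
  rw [hb, inv_one, Ad_one]

/-- Hence the flat straight average read on the coarse lattice is `Qcoarse L Y z κ = S_1(L•z, κ)`. [folklore] -/
theorem Qcoarse_eq_segMain_flat [Nonempty n] {L : ℕ} (hL : 1 ≤ L) (Y : Site d → Fin d → Matrix n n ℂ) (z : Site d) (κ : Fin d) :
    Qcoarse L Y z κ = segMain L (flat (d := d) (n := n)) Y ((L : ℤ) • z) κ := by
  rw [← Qbar_flat (d := d) (n := n) hL Y]
  exact dbarLin_flat_eq_segMain L hL Y _ κ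

end

end Summit.QuantumFields.BalabanUV.T4Continuum.NE7TransportDeviationLetters
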